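import Mathlib
import Summits.QuantumFields.YangMills.Theorems.BalabanUVNodesN15BackgroundPropagatorV
import HarnessLib

/-!
# Route «BalabanUVNodes» (cluster K4 «SpineRates»), Track-A DAG node N15 = spine estimate NE2, BACKGROUND LAYER — THE FIRST-ORDER PERTURBATION SPECIES
# `V = M_c + Σ_μ M_{a_μ}∘∇_μ` IN THE CONSTRUCTED PAIR BY THE STACKED NEUMANN DEVICE: the `U ≡ 1` piece stacked with its derived pieces on the carrier
# `X × Option J`, the unstacked perturbation, and the η-defect of the background-dependent pair `(X(U), ∇_μX(U))_μ` — no derivative of a pulled-back function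

Cell `pub-ymgap`, seat `pub-ymgap-dag-n15-b` (generation g5; FIRST-MISSING-ESTIMATE, HUMAN RULING D-0062; chair R424 venue; ROSTER-D0062 l.26).
`bears_on: R4∕N15`.  Filed `--supports stmt-QuantumFields-19351` (helper).  Imports part B1a `…N15.BackgroundLayer` (`bgPropV`, `bgPropV_fix`, `hasMaj_idef_bgPropV`)
and through it the lineage BY NAME; nothing in the tree is modified.

THE PRINT (MECHANISM and SHAPES only; nothing of [B9] asserted).  [Balaban1985BackgroundPropagators] (3.52) p. 400: *«V′₁(A)λ(x) = Σ_b i[A′(b), (D^η_Uλ)(b)] +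
i[(D^{η*}_U A)(x), λ(x)] + …»* — a FIRST-ORDER difference operator with (3.35)-small coefficients; (3.63) p. 402: *«|(V′(A)G′(U)λ)(x)| ≦ O(1)B₀α₁e^{−δ₀d(y,y′)}»* —
the Neumann step is the perturbation AFTER the propagator, bounded through the DERIVATIVE ENTRY (3.42)₂ of `G′`, never through `V′` alone (the difference
quotient costs `η⁻¹`).  Device (this file): STACK the `U ≡ 1` piece with its derived pieces, `Ĝλ = (Gλ, (D_μλ)_μ)` on `X × Option J` (`D_μ` = the `U ≡ 1`
derivative piece `∇_μG`, King's separate kernel (3.73) p. 665), and UNSTACK the perturbation, `V̂(f) = M_c f(·, none) + Σ_μ M_{a_μ} f(·, some μ)`: then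
`V∘X = V̂∘X̂` for `X̂ = (X, ∇_μX)_μ`, the background-dependent pair solves `X̂ = Ĝ + (Ĝ∘V̂)∘X̂` — part B1a's rectangular fixed point with a perturbation of
DIAGONAL majorant `diagK (r(1 + |J|))` — its `none` component IS the background propagator `X = G + G∘(V∘X)` and its `some μ` component IS `∇_μX`
(`projO_some_bgPair`), and the η-defect of the pair is B1a's `hasMaj_idef_bgPropV` with the stacked `U ≡ 1` defect and the unstacked coefficient fits —
NO derivative of a pulled-back function appears (g0 file 7's obstruction: *«the piecewise-constant pull-back has jumps of relative size one at the block faces»*).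

CONTENTS ([folklore] plumbing + bookkeeping; 5 defs).
* §1 `projO`, `stack` (`stack_apply_none∕some`, `projO_none_comp_stack`, `projO_some_comp_stack`), `unstack` (`unstack_apply`), `liftPair`, `blkPair`;
  majorants: `hasMaj_stack` (a common majorant of the pieces majorises the stack), `hasMaj_projO_comp` (components inherit the stack's majorant),
  `hasMaj_unstack` (`diagK (r(1 + |J|))` from the sup letters), `idef_stack` (the stacked defect IS the stack of the defects), `idef_unstack_apply` +
  `hasMaj_idef_unstack` (the unstacked coefficient defect is diagonal, `diagK (o(1 + |J|))`, from the fits).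
* §2 THE FIRST-ORDER BACKGROUND-DEPENDENT PAIR `bgPair G D c a := bgPropV (stack G D) (unstack c a)`: `projO_none_bgPair` (`X = G + G∘V̂∘X̂` — (3.65) for the
  propagator itself), `projO_some_bgPair` (`∇_μ`-component `= D_μ + D_μ∘V̂∘X̂`; `= P_μ∘X` when `D_μ = P_μ∘G`: `projO_some_bgPair_of_comp`), and
  **`hasMaj_idef_bgPair`** — the η-defect of the first-order pair through `(pull π, pull (liftPair π))`:
  `≤ (m c_r + m c_r·(Rβ(1−q)⁻¹) + β·O·β(1−q)⁻¹·c_r)(1−q)⁻¹·e^{−ρd}`, `R = r(1 + |J|)`, `O = o(1 + |J|)`, `q = βRc_r < 1`, from the `U ≡ 1` layer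
  (majorants `β·e^{−δd}` of `G, D_μ, G′, D′_μ`, defects `m·e^{−δd}` of `(G′,G), (D′_μ,D_μ)`) and the (3.35)-shaped letters of ALL coefficients (sup `≤ r`, fits `≤ o`);
  `hasMaj_idef_bgPair_proj` (entries 0 (`j = none`) and 1 (`j = some μ`) of the first-order background-dependent pair, read off the components).

HONEST FRAMING ∕ LIMITS.  MECHANISM + linear algebra over hypothesis-shaped data; scalar coefficients (the matrix species `ad_{A′}` of parts 13–19 enter
through the product-carrier device of part 14 — not wired here); linearised transport for the fits (any `c̄, ā_μ` with the fit letters; the block average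
of A1∕A2 is one choice); the `U ≡ 1` layer (pieces, derived pieces, their defects) DISPLAYED; nothing about Bałaban's `G(U)` of [B6]∕[B9] asserted.  NE2⁺
NOT PRINTED, NOT proved; count-neutral (typed 28∕28; nothing discharged); N15 NOT discharged; one finite lattice at fixed ε — NOT infinite volume, NOT OS
on ℝ⁴, NOT a mass gap, NOT Clay.
-/

noncomputable section

open scoped BigOperators

namespace Summit.QuantumFields.YangMills.BalabanUVNodes.N15.BackgroundLayer

open Literature.MathematicalPhysics.QuantumFieldTheory.Balaban1983to89
open Literature.MathematicalPhysics.QuantumFieldTheory.Balaban1983to89.B11SectG (BlockNorm HasMaj RowSum)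
open Literature.MathematicalPhysics.QuantumFieldTheory.Balaban1983to89.T4EtaRateDefect (idef idef_apply)
open Literature.MathematicalPhysics.QuantumFieldTheory.Balaban1983to89.T4EtaRateCoeffDefect (pull pull_apply diagK diagK_same diagK_ne diagK_nonneg)
open Literature.MathematicalPhysics.QuantumFieldTheory.Balaban1983to89.B6RandomWalk (Triangle254)
open Literature.MathematicalPhysics.QuantumFieldTheory.Balaban1983to89.B6Prop26Gluing (mulOp mulOp_apply)
open Literature.MathematicalPhysics.QuantumFieldTheory.Balaban1983to89.B11AxialTransport190 (abs_le_loc_ofBlocks loc_ofBlocks_le)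

/-! ## §1 Stacking and unstacking -/

section Stack

variable {X X' J : Type} {F F' : Type} [AddCommGroup F] [Module ℝ F] [AddCommGroup F'] [Module ℝ F']

/-- THE COMPONENT PROJECTION `f ↦ f(·, j)` of the stacked carrier (a pull-back along the section `x ↦ (x, j)`). [folklore] -/
def projO (j : Option J) : (X × Option J → ℝ) →ₗ[ℝ] (X → ℝ) := pull fun x => (x, j)

/-- Unfolding. [folklore] -/
@[simp] theorem projO_apply (j : Option J) (f : X × Option J → ℝ) (x : X) : projO j f x = f (x, j) := rfl

/-- THE STACKED OPERATOR `λ ↦ (Gλ, (D_μλ)_μ)` on the carrier `X × Option J` (component `none` = the piece, `some μ` = the derived piece `μ`).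
[cite: King1986, Prop. 3.9 (3.73) p.665 (the derivative kernel as a separate kernel: shape)] -/
def stack (G : F →ₗ[ℝ] (X → ℝ)) (D : J → F →ₗ[ℝ] (X → ℝ)) : F →ₗ[ℝ] (X × Option J → ℝ) where
  toFun v p := Option.elim p.2 (G v p.1) (fun μ => D μ v p.1)
  map_add' v w := by
    funext p
    rcases p with ⟨x, _ | μ⟩ <;> simp
  map_smul' r v := by
    funext p
    rcases p with ⟨x, _ | μ⟩ <;> simp

/-- The `none` component of the stack is the piece. [folklore] -/
@[simp] theorem stack_apply_none (G : F →ₗ[ℝ] (X → ℝ)) (D : J → F →ₗ[ℝ] (X → ℝ)) (v : F) (x : X) : stack G D v (x, none) = G v x := rfl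

/-- The `some μ` component of the stack is the derived piece `μ`. [folklore] -/
@[simp] theorem stack_apply_some (G : F →ₗ[ℝ] (X → ℝ)) (D : J → F →ₗ[ℝ] (X → ℝ)) (v : F) (x : X) (μ : J) :
    stack G D v (x, some μ) = D μ v x := rfl

/-- `projO none ∘ stack G D = G`. [folklore] -/
theorem projO_none_comp_stack (G : F →ₗ[ℝ] (X → ℝ)) (D : J → F →ₗ[ℝ] (X → ℝ)) : projO none ∘ₗ stack G D = G := rfl

/-- `projO (some μ) ∘ stack G D = D μ`. [folklore] -/
theorem projO_some_comp_stack (G : F →ₗ[ℝ] (X → ℝ)) (D : J → F →ₗ[ℝ] (X → ℝ)) (μ : J) : projO (some μ) ∘ₗ stack G D = D μ := rfl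

variable [Fintype J]

/-- THE UNSTACKED FIRST-ORDER PERTURBATION `V̂ f = M_c f(·, none) + Σ_μ M_{a_μ} f(·, some μ)` — so that `V∘X = V̂∘(X, ∇_μX)_μ` for `V = M_c + Σ_μ M_{a_μ}∘∇_μ`.
[cite: Balaban1985BackgroundPropagators, (3.52) p.400 (first-order perturbation: shape)] -/
def unstack (c : X → ℝ) (a : J → X → ℝ) : (X × Option J → ℝ) →ₗ[ℝ] (X → ℝ) :=
  mulOp c ∘ₗ projO none + ∑ μ, mulOp (a μ) ∘ₗ projO (some μ)

/-- Unfolding. [folklore] -/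
theorem unstack_apply (c : X → ℝ) (a : J → X → ℝ) (f : X × Option J → ℝ) (x : X) :
    unstack c a f x = c x * f (x, none) + ∑ μ, a μ x * f (x, some μ) := by
  simp [unstack, LinearMap.sum_apply, Finset.sum_apply, mulOp_apply]

/-- THE LIFTED PAIRING of the stacked carriers: `(x′, j) ↦ (π x′, j)`. [folklore] -/
abbrev liftPair (π : X' → X) : X' × Option J → X × Option J := fun p => (π p.1, p.2)

/-- Pointwise form of the unstacked coefficient defect through `(pull (liftPair π), pull π)`: multiplication by the FIT ERRORS, component by component. [folklore] -/
theorem idef_unstack_apply (π : X' → X) (c : X → ℝ) (a : J → X → ℝ) (c' : X' → ℝ) (a' : J → X' → ℝ) (f : X × Option J → ℝ) (x' : X') :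
    idef (pull (liftPair π)) (pull π) (unstack c' a') (unstack c a) f x' =
      (c' x' - c (π x')) * f (π x', none) + ∑ μ, (a' μ x' - a μ (π x')) * f (π x', some μ) := by
  simp only [idef_apply, Pi.sub_apply, unstack_apply, pull_apply, sub_mul, Finset.sum_sub_distrib]
  ring

omit [Fintype J] in
/-- THE STACKED DEFECT IS THE STACK OF THE DEFECTS: `𝔇(stack G′ D′, stack G D) = stack (𝔇(G′, G)) (𝔇(D′_μ, D_μ))_μ` through `(τ₁, pull (liftPair π))`.
[folklore] -/
theorem idef_stack (τ₁ : F →ₗ[ℝ] F') (π : X' → X) (G : F →ₗ[ℝ] (X → ℝ)) (D : J → F →ₗ[ℝ] (X → ℝ)) (G' : F' →ₗ[ℝ] (X' → ℝ))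
    (D' : J → F' →ₗ[ℝ] (X' → ℝ)) :
    idef τ₁ (pull (liftPair π)) (stack G' D') (stack G D) = stack (idef τ₁ (pull π) G' G) (fun μ => idef τ₁ (pull π) (D' μ) (D μ)) := by
  refine LinearMap.ext fun v => funext fun p => ?_
  rcases p with ⟨x', _ | μ⟩ <;> rfl

variable [Fintype X] [Fintype X'] {g : B6.Geometry} (blk : X → g.Site)

/-- THE STACKED BLOCK ASSIGNMENT: a point `(x, j)` lies in the block of `x`. [folklore] -/
abbrev blkPair (blk : X → g.Site) : X × Option J → g.Site := fun p => blk p.1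

/-- A COMMON MAJORANT OF THE PIECES MAJORISES THE STACK (`K ≥ 0`). [folklore] -/
theorem hasMaj_stack {b₁ : BlockNorm g F} {G : F →ₗ[ℝ] (X → ℝ)} {D : J → F →ₗ[ℝ] (X → ℝ)} {K : g.Site → g.Site → ℝ}
    (hK : ∀ y y', 0 ≤ K y y') (hG : HasMaj b₁ (BlockNorm.ofBlocks g blk) G K) (hD : ∀ μ, HasMaj b₁ (BlockNorm.ofBlocks g blk) (D μ) K) :
    HasMaj b₁ (BlockNorm.ofBlocks g (blkPair blk)) (stack G D) K := by
  intro y' v hv y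
  refine loc_ofBlocks_le (blkPair blk) _ (mul_nonneg (hK y y') (b₁.loc_nonneg y' v)) fun p hp => ?_
  rcases p with ⟨x, _ | μ⟩
  · exact (abs_le_loc_ofBlocks blk (G v) hp).trans (hG y' v hv y)
  · exact (abs_le_loc_ofBlocks blk (D μ v) hp).trans (hD μ y' v hv y)

/-- COMPONENTS INHERIT THE STACK'S MAJORANT. [folklore] -/
theorem hasMaj_projO_comp {b₁ : BlockNorm g F} {T : F →ₗ[ℝ] (X × Option J → ℝ)} {K : g.Site → g.Site → ℝ}
    (h : HasMaj b₁ (BlockNorm.ofBlocks g (blkPair blk)) T K) (j : Option J) : HasMaj b₁ (BlockNorm.ofBlocks g blk) (projO j ∘ₗ T) K := by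
  intro y' v hv y
  refine loc_ofBlocks_le blk _ (((BlockNorm.ofBlocks g (blkPair (J := J) blk)).loc_nonneg _ _).trans (h y' v hv y)) fun x hx => ?_
  exact (abs_le_loc_ofBlocks (blkPair blk) (T v) (x' := (x, j)) hx).trans (h y' v hv y)

/-- THE UNSTACKED PERTURBATION HAS THE DIAGONAL MAJORANT `diagK (r(1 + |J|))` from the sup letters `|c|, |a_μ| ≤ r`. [cite: Balaban1985BackgroundPropagators, (3.35) p.396 («|A| < O(1)Mα₀(L^jη)^{−1}»: shape)] -/
theorem hasMaj_unstack {c : X → ℝ} {a : J → X → ℝ} {r : ℝ} (hr : 0 ≤ r) (hc : ∀ x, |c x| ≤ r) (ha : ∀ μ x, |a μ x| ≤ r) :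
    HasMaj (BlockNorm.ofBlocks g (blkPair blk)) (BlockNorm.ofBlocks g blk) (unstack c a) (diagK fun _ => r * (1 + Fintype.card J)) := by
  intro y' f hf y
  have hf' : ∀ p : X × Option J, blk p.1 ≠ y' → f p = 0 := hf
  by_cases hy : y = y'
  · subst hy
    rw [diagK_same]
    set L : ℝ := (BlockNorm.ofBlocks g (blkPair (J := J) blk)).loc y f with hL_def
    have hL0 : 0 ≤ L := (BlockNorm.ofBlocks g (blkPair (J := J) blk)).loc_nonneg y f
    refine loc_ofBlocks_le blk _ (by positivity) fun x hx => ?_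
    have hL : ∀ j : Option J, |f (x, j)| ≤ L := fun j => abs_le_loc_ofBlocks (blkPair blk) f (x' := (x, j)) hx
    have h1 : |c x * f (x, none)| ≤ r * L := by
      rw [abs_mul]; exact mul_le_mul (hc x) (hL none) (abs_nonneg _) hr
    have h2 : ∀ μ, |a μ x * f (x, some μ)| ≤ r * L := fun μ => by
      rw [abs_mul]; exact mul_le_mul (ha μ x) (hL _) (abs_nonneg _) hr
    rw [unstack_apply]
    calc |c x * f (x, none) + ∑ μ, a μ x * f (x, some μ)|
        ≤ |c x * f (x, none)| + ∑ μ, |a μ x * f (x, some μ)| := (abs_add_le _ _).trans (add_le_add le_rfl (Finset.abs_sum_le_sum_abs _ _))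
      _ ≤ r * L + ∑ _μ : J, r * L := add_le_add h1 (Finset.sum_le_sum fun μ _ => h2 μ)
      _ = r * (1 + Fintype.card J) * L := by rw [Finset.sum_const, Finset.card_univ, nsmul_eq_mul]; ring
  · rw [diagK_ne _ hy, zero_mul]
    refine loc_ofBlocks_le blk _ le_rfl fun x hx => ?_
    have h0 : ∀ j : Option J, f (x, j) = 0 := fun j => hf' (x, j) (by rw [hx]; exact hy)
    simp [unstack_apply, h0]

/-- THE UNSTACKED COEFFICIENT DEFECT IS DIAGONAL: `𝔇(V̂′, V̂) ≤ diagK (o(1 + |J|))` from the FIT LETTERS `|c′ − c∘π|, |a′_μ − a_μ∘π| ≤ o` (`o ≥ 0`).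
[folklore] -/
theorem hasMaj_idef_unstack (π : X' → X) {c : X → ℝ} {a : J → X → ℝ} {c' : X' → ℝ} {a' : J → X' → ℝ} {o : ℝ} (ho : 0 ≤ o)
    (hc : ∀ x', |c' x' - c (π x')| ≤ o) (ha : ∀ μ x', |a' μ x' - a μ (π x')| ≤ o) :
    HasMaj (BlockNorm.ofBlocks g (blkPair blk)) (BlockNorm.ofBlocks g (blk ∘ π))
      (idef (pull (liftPair π)) (pull π) (unstack c' a') (unstack c a)) (diagK fun _ => o * (1 + Fintype.card J)) := by
  intro y' f hf y
  have hf' : ∀ p : X × Option J, blk p.1 ≠ y' → f p = 0 := hf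
  by_cases hy : y = y'
  · subst hy
    rw [diagK_same]
    set L : ℝ := (BlockNorm.ofBlocks g (blkPair (J := J) blk)).loc y f with hL_def
    have hL0 : 0 ≤ L := (BlockNorm.ofBlocks g (blkPair (J := J) blk)).loc_nonneg y f
    refine loc_ofBlocks_le (blk ∘ π) _ (by positivity) fun x' hx' => ?_
    have hx : blk (π x') = y := hx'
    have hL : ∀ j : Option J, |f (π x', j)| ≤ L := fun j => abs_le_loc_ofBlocks (blkPair blk) f (x' := (π x', j)) hx
    have h1 : |(c' x' - c (π x')) * f (π x', none)| ≤ o * L := by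
      rw [abs_mul]; exact mul_le_mul (hc x') (hL none) (abs_nonneg _) ho
    have h2 : ∀ μ, |(a' μ x' - a μ (π x')) * f (π x', some μ)| ≤ o * L := fun μ => by
      rw [abs_mul]; exact mul_le_mul (ha μ x') (hL _) (abs_nonneg _) ho
    rw [idef_unstack_apply]
    calc |(c' x' - c (π x')) * f (π x', none) + ∑ μ, (a' μ x' - a μ (π x')) * f (π x', some μ)|
        ≤ |(c' x' - c (π x')) * f (π x', none)| + ∑ μ, |(a' μ x' - a μ (π x')) * f (π x', some μ)| :=
          (abs_add_le _ _).trans (add_le_add le_rfl (Finset.abs_sum_le_sum_abs _ _))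
      _ ≤ o * L + ∑ _μ : J, o * L := add_le_add h1 (Finset.sum_le_sum fun μ _ => h2 μ)
      _ = o * (1 + Fintype.card J) * L := by rw [Finset.sum_const, Finset.card_univ, nsmul_eq_mul]; ring
  · rw [diagK_ne _ hy, zero_mul]
    refine loc_ofBlocks_le (blk ∘ π) _ le_rfl fun x' hx' => ?_
    have hx : blk (π x') = y := hx'
    have h0 : ∀ j : Option J, f (π x', j) = 0 := fun j => hf' (π x', j) (by rw [hx]; exact hy)
    simp [idef_unstack_apply, h0]

end Stack

/-! ## §2 The first-order background-dependent pair and its η-defect -/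

section Pair

variable {X X' J : Type} [Fintype X] [Fintype X'] [Fintype J] [DecidableEq X] [DecidableEq X'] [DecidableEq J] {g : B6.Geometry}
  (blk : X → g.Site) (π : X' → X)

/-- THE FIRST-ORDER BACKGROUND-DEPENDENT PAIR `X̂ = (1 − Ĝ∘V̂)⁻¹Ĝ` of a `U ≡ 1` piece `G`, its derived pieces `D_μ` (= `∇_μG`) and the coefficients `c, a_μ` of
`V = M_c + Σ_μ M_{a_μ}∘∇_μ`: component `none` = the background propagator `X(U)`, component `some μ` = `∇_μX(U)`. [cite: Balaban1985BackgroundPropagators, (3.64) p.403 (shape)] -/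
def bgPair (G : (X → ℝ) →ₗ[ℝ] (X → ℝ)) (D : J → (X → ℝ) →ₗ[ℝ] (X → ℝ)) (c : X → ℝ) (a : J → X → ℝ) : (X → ℝ) →ₗ[ℝ] (X × Option J → ℝ) :=
  bgPropV (stack G D) (unstack c a)

variable {G : (X → ℝ) →ₗ[ℝ] (X → ℝ)} {D : J → (X → ℝ) →ₗ[ℝ] (X → ℝ)} {c : X → ℝ} {a : J → X → ℝ}

/-- **THE PROPAGATOR COMPONENT SOLVES (3.65)**: `X = G + G∘(V̂∘X̂)` with `V̂∘X̂ = M_cX + Σ_μ M_{a_μ}(∇_μX)` — the print's `X = G + G∘V∘X` for the first-order `V`.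
[cite: Balaban1985BackgroundPropagators, (3.65) p.403 (shape)] -/
theorem projO_none_bgPair (hunit : IsUnit (1 - LinearMap.toMatrix' (stack G D ∘ₗ unstack c a))) :
    projO none ∘ₗ bgPair G D c a = G + G ∘ₗ (unstack c a ∘ₗ bgPair G D c a) := by
  unfold bgPair
  conv_lhs => rw [bgPropV_fix hunit]
  rw [LinearMap.comp_add, projO_none_comp_stack]
  rfl

/-- THE DERIVATIVE COMPONENT: `X̂_μ = D_μ + D_μ∘(V̂∘X̂)`. [cite: King1986, Prop. 3.9 (3.73) p.665 (separate derivative kernel: shape)] -/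
theorem projO_some_bgPair (hunit : IsUnit (1 - LinearMap.toMatrix' (stack G D ∘ₗ unstack c a))) (μ : J) :
    projO (some μ) ∘ₗ bgPair G D c a = D μ + D μ ∘ₗ (unstack c a ∘ₗ bgPair G D c a) := by
  unfold bgPair
  conv_lhs => rw [bgPropV_fix hunit]
  rw [LinearMap.comp_add, projO_some_comp_stack]
  rfl

/-- INTERPRETATION: if the derived piece IS the derivative of the piece, `D_μ = P_μ∘G`, then the derivative component IS the derivative of the propagator
component, `X̂_μ = P_μ∘X` — the stacked unknown is `(X, ∇_μX)_μ` as intended. [folklore] -/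
theorem projO_some_bgPair_of_comp (hunit : IsUnit (1 - LinearMap.toMatrix' (stack G D ∘ₗ unstack c a))) {μ : J} {P : (X → ℝ) →ₗ[ℝ] (X → ℝ)}
    (hD : D μ = P ∘ₗ G) : projO (some μ) ∘ₗ bgPair G D c a = P ∘ₗ (projO none ∘ₗ bgPair G D c a) := by
  rw [projO_some_bgPair hunit, projO_none_bgPair hunit, hD, LinearMap.comp_add]
  rfl

variable {G' : (X' → ℝ) →ₗ[ℝ] (X' → ℝ)} {D' : J → (X' → ℝ) →ₗ[ℝ] (X' → ℝ)} {c' : X' → ℝ} {a' : J → X' → ℝ}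

/-- **THE η-DEFECT OF THE FIRST-ORDER BACKGROUND-DEPENDENT PAIR.**  Data: a [B6] carrier ((2.54), `d ≥ 0`, (2.61) at `σ ≥ 0` with `c_r ≥ 0`); coarse∕fine lattices
blocked and paired; the `U ≡ 1` LAYER — pieces `G, G′` and derived pieces `D_μ, D′_μ` with block majorants `β·e^{−δd}`, defects `𝔇(G′,G), 𝔇(D′_μ,D_μ) ≤ m·e^{−δd}`
(`m ≥ 0` carries the rate factor); the COEFFICIENTS of `V = M_c + Σ_μ M_{a_μ}∘∇_μ` at both spacings with the (3.35)-shaped sup letters `|c|, |a_μ|, |c′|, |a′_μ| ≤ r`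
and fit letters `|c′ − c∘π|, |a′_μ − a_μ∘π| ≤ o`; rate `0 ≤ ρ`, `ρ + σ ≤ δ`; smallness `q = β·R·c_r < 1` with `R = r(1 + |J|)` (the model's (3.63)).  CONCLUSION: with
`O = o(1 + |J|)`, `𝔇(X̂′, X̂) ≤ (m c_r + m c_r·(R·β(1−q)⁻¹) + β·O·β(1−q)⁻¹·c_r)(1−q)⁻¹·e^{−ρd}` through `(pull π, pull (liftPair π))` — B1a with every perturbation
letter DISCHARGED from the coefficients and the stacked `U ≡ 1` defect read off the pieces'. [cite: Balaban1985BackgroundPropagators, (3.52) p.400, (3.63)–(3.65) pp.402–403 (shapes, mechanism)] -/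
theorem hasMaj_idef_bgPair (htri : Triangle254 g) (hd : ∀ a b : g.Site, 0 ≤ g.dist a b) {σ cr : ℝ} (hσ : 0 ≤ σ) (hcr : 0 ≤ cr) (hrow : RowSum g σ cr)
    {ρ δ β r o m : ℝ} (hρ : 0 ≤ ρ) (hρδ : ρ + σ ≤ δ) (hβ : 0 ≤ β) (hr : 0 ≤ r) (ho : 0 ≤ o) (hm : 0 ≤ m)
    (hG : HasMaj (BlockNorm.ofBlocks g blk) (BlockNorm.ofBlocks g blk) G (fun y y' => β * Real.exp (-(δ * g.dist y y'))))
    (hD : ∀ μ, HasMaj (BlockNorm.ofBlocks g blk) (BlockNorm.ofBlocks g blk) (D μ) (fun y y' => β * Real.exp (-(δ * g.dist y y'))))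
    (hG' : HasMaj (BlockNorm.ofBlocks g (blk ∘ π)) (BlockNorm.ofBlocks g (blk ∘ π)) G' (fun y y' => β * Real.exp (-(δ * g.dist y y'))))
    (hD' : ∀ μ, HasMaj (BlockNorm.ofBlocks g (blk ∘ π)) (BlockNorm.ofBlocks g (blk ∘ π)) (D' μ) (fun y y' => β * Real.exp (-(δ * g.dist y y'))))
    (hDG : HasMaj (BlockNorm.ofBlocks g blk) (BlockNorm.ofBlocks g (blk ∘ π)) (idef (pull π) (pull π) G' G)
      (fun y y' => m * Real.exp (-(δ * g.dist y y'))))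
    (hDD : ∀ μ, HasMaj (BlockNorm.ofBlocks g blk) (BlockNorm.ofBlocks g (blk ∘ π)) (idef (pull π) (pull π) (D' μ) (D μ))
      (fun y y' => m * Real.exp (-(δ * g.dist y y'))))
    (hc : ∀ x, |c x| ≤ r) (ha : ∀ μ x, |a μ x| ≤ r) (hc' : ∀ x', |c' x'| ≤ r) (ha' : ∀ μ x', |a' μ x'| ≤ r)
    (hfc : ∀ x', |c' x' - c (π x')| ≤ o) (hfa : ∀ μ x', |a' μ x' - a μ (π x')| ≤ o)
    (hq : β * (r * (1 + Fintype.card J)) * cr < 1) :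
    HasMaj (BlockNorm.ofBlocks g blk) (BlockNorm.ofBlocks g (blkPair (blk ∘ π)))
      (idef (pull π) (pull (liftPair π)) (bgPair G' D' c' a') (bgPair G D c a))
      (fun y y' => (m * cr + 1 * (m * cr) * (r * (1 + Fintype.card J) * (β * (1 - β * (r * (1 + Fintype.card J)) * cr)⁻¹)) +
          β * (o * (1 + Fintype.card J)) * (β * (1 - β * (r * (1 + Fintype.card J)) * cr)⁻¹) * cr) *
        (1 - 1 * (β * (r * (1 + Fintype.card J)) * cr))⁻¹ * Real.exp (-(ρ * g.dist y y'))) := by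
  have hβe : ∀ y y' : g.Site, 0 ≤ β * Real.exp (-(δ * g.dist y y')) := fun _ _ => mul_nonneg hβ (Real.exp_nonneg _)
  have hme : ∀ y y' : g.Site, 0 ≤ m * Real.exp (-(δ * g.dist y y')) := fun _ _ => mul_nonneg hm (Real.exp_nonneg _)
  have hJ : (0 : ℝ) ≤ 1 + Fintype.card J := by positivity
  -- the U ≡ 1 layer, stacked
  have hSG := hasMaj_stack blk hβe hG hD
  have hSG' := hasMaj_stack (blk ∘ π) hβe hG' hD'
  have hSD : HasMaj (BlockNorm.ofBlocks g blk) (BlockNorm.ofBlocks g (blkPair (blk ∘ π)))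
      (idef (pull π) (pull (liftPair π)) (stack G' D') (stack G D)) (fun y y' => m * Real.exp (-(δ * g.dist y y'))) := by
    rw [idef_stack]
    exact hasMaj_stack (blk ∘ π) hme hDG hDD
  -- the perturbation letters, unstacked
  have hV := hasMaj_unstack blk hr hc ha
  have hV' := hasMaj_unstack (blk ∘ π) hr hc' ha'
  have hDV := hasMaj_idef_unstack blk π ho hfc hfa
  exact hasMaj_idef_bgPropV blk (blkPair blk) π (liftPair π) htri hd hσ hcr hrow hρ hρδ hβ (mul_nonneg hr hJ) (mul_nonneg ho hJ) hm hSG hSG' hSD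
    hV hV' hDV hq

/-- **ENTRY 0 OF THE FIRST-ORDER BACKGROUND-DEPENDENT PAIR** (the propagator component): `𝔇(X′, X)` inherits the pair's majorant. [cite: Balaban1985BackgroundPropagators, Thm 3.1 (3.42) p.397 (first entry: shape)] -/
theorem hasMaj_idef_bgPair_proj (htri : Triangle254 g) (hd : ∀ a b : g.Site, 0 ≤ g.dist a b) {σ cr : ℝ} (hσ : 0 ≤ σ) (hcr : 0 ≤ cr) (hrow : RowSum g σ cr)
    {ρ δ β r o m : ℝ} (hρ : 0 ≤ ρ) (hρδ : ρ + σ ≤ δ) (hβ : 0 ≤ β) (hr : 0 ≤ r) (ho : 0 ≤ o) (hm : 0 ≤ m)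
    (hG : HasMaj (BlockNorm.ofBlocks g blk) (BlockNorm.ofBlocks g blk) G (fun y y' => β * Real.exp (-(δ * g.dist y y'))))
    (hD : ∀ μ, HasMaj (BlockNorm.ofBlocks g blk) (BlockNorm.ofBlocks g blk) (D μ) (fun y y' => β * Real.exp (-(δ * g.dist y y'))))
    (hG' : HasMaj (BlockNorm.ofBlocks g (blk ∘ π)) (BlockNorm.ofBlocks g (blk ∘ π)) G' (fun y y' => β * Real.exp (-(δ * g.dist y y'))))
    (hD' : ∀ μ, HasMaj (BlockNorm.ofBlocks g (blk ∘ π)) (BlockNorm.ofBlocks g (blk ∘ π)) (D' μ) (fun y y' => β * Real.exp (-(δ * g.dist y y'))))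
    (hDG : HasMaj (BlockNorm.ofBlocks g blk) (BlockNorm.ofBlocks g (blk ∘ π)) (idef (pull π) (pull π) G' G)
      (fun y y' => m * Real.exp (-(δ * g.dist y y'))))
    (hDD : ∀ μ, HasMaj (BlockNorm.ofBlocks g blk) (BlockNorm.ofBlocks g (blk ∘ π)) (idef (pull π) (pull π) (D' μ) (D μ))
      (fun y y' => m * Real.exp (-(δ * g.dist y y'))))
    (hc : ∀ x, |c x| ≤ r) (ha : ∀ μ x, |a μ x| ≤ r) (hc' : ∀ x', |c' x'| ≤ r) (ha' : ∀ μ x', |a' μ x'| ≤ r)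
    (hfc : ∀ x', |c' x' - c (π x')| ≤ o) (hfa : ∀ μ x', |a' μ x' - a μ (π x')| ≤ o)
    (hq : β * (r * (1 + Fintype.card J)) * cr < 1) (j : Option J) :
    HasMaj (BlockNorm.ofBlocks g blk) (BlockNorm.ofBlocks g (blk ∘ π))
      (idef (pull π) (pull π) (projO j ∘ₗ bgPair G' D' c' a') (projO j ∘ₗ bgPair G D c a))
      (fun y y' => (m * cr + 1 * (m * cr) * (r * (1 + Fintype.card J) * (β * (1 - β * (r * (1 + Fintype.card J)) * cr)⁻¹)) +
          β * (o * (1 + Fintype.card J)) * (β * (1 - β * (r * (1 + Fintype.card J)) * cr)⁻¹) * cr) *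
        (1 - 1 * (β * (r * (1 + Fintype.card J)) * cr))⁻¹ * Real.exp (-(ρ * g.dist y y'))) := by
  have key := hasMaj_idef_bgPair blk π htri hd hσ hcr hrow hρ hρδ hβ hr ho hm hG hD hG' hD' hDG hDD hc ha hc' ha' hfc hfa hq
  have hcomp : idef (pull π) (pull π) (projO j ∘ₗ bgPair G' D' c' a') (projO j ∘ₗ bgPair G D c a) =
      projO j ∘ₗ idef (pull π) (pull (liftPair π)) (bgPair G' D' c' a') (bgPair G D c a) :=
    LinearMap.ext fun v => funext fun x' => rfl
  rw [hcomp]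
  exact hasMaj_projO_comp (blk ∘ π) key j

end Pair

end Summit.QuantumFields.YangMills.BalabanUVNodes.N15.BackgroundLayer
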